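import Literature.NumberTheory.Transcendental.PhilipponZeroEstimateOneFactor
import Literature.NumberTheory.Transcendental.ThetaSubgroupClassification
import Literature.NumberTheory.Transcendental.PkappaHardData
import HarnessLib

/-!
# Philippon's zero estimate on `M_κ`, at most one elliptic factor (CM allowed) — discharge

Discharge of the named fact `Literature.NumberTheory.Transcendental.philippon1986_oneFactor`
(`PhilipponZeroEstimateOneFactor.lean`): Philippon 1986, Thm. 2.1, in the standard uniformisation
of `M_κ = 𝔾ₘ^β × P_κ` with `|γ| ≤ 1` and complex multiplication allowed.

Everything is already in the tree (D. Roy's proof of Philippon's theorem, LNM 1752 Ch. 11,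
formalised in the `ZeroEst*`, `Pkappa*`, `ThetaSubgroup*` files):
`GaGmE.Std.zeroEstimate_oneFactor_of_hardData` (`ThetaSubgroupClassification.lean`) is exactly
the body of the fact *given* the hard data of the theta embedding, and that hard data is supplied
unconditionally by `GaGmE.Std.hardData` (`PkappaHardData.lean`) — the same two ingredients that
give `philippon1986_std_holds` (`PhilipponZeroEstimateStdProofs.lean`) in the no-CM case.

## References
* [Philippon1986] P. Philippon, *Lemmes de zéros dans les groupes algébriques commutatifs*,
  Bull. Soc. Math. France 114 (1986) 355–383, Thm. 2.1.
* [NesterenkoPhilippon2001] Yu. V. Nesterenko, P. Philippon (eds.), *Introduction to Algebraic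
  Independence Theory*, LNM 1752 (2001), Ch. 11 (D. Roy), Thm. 4.1.
-/

noncomputable section

namespace Literature.NumberTheory.Transcendental

/-- **Philippon's zero estimate (1986, Thm. 2.1) on `M_κ`, standard uniformisation, at most one
elliptic factor, complex multiplication allowed: the named fact `philippon1986_oneFactor`
holds** — Roy's zero estimate for the theta model (`GaGmE.Std.zeroEstimate_oneFactor_of_hardData`)
on the unconditional hard data `GaGmE.Std.hardData`.
[cite: Philippon1986, Thm 2.1] [cite: NesterenkoPhilippon2001, Ch. 11 Thm. 4.1] -/
theorem philippon1986_oneFactor_holds : philippon1986_oneFactor := by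
  intro L _ _ β γ δ _ _ _ _ κM hγ
  classical
  exact GaGmE.Std.zeroEstimate_oneFactor_of_hardData L κM (GaGmE.Std.hardData L κM) hγ

end Literature.NumberTheory.Transcendental

end
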